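import Summits.ResolutionOfSingularities.ResolutionOfSingularities.Theorems.FrobeniusLadderFInjectiveMacaulayficationRegularBlowupModelDim2
import Summits.ResolutionOfSingularities.ResolutionOfSingularities.Theorems.FrobeniusLadderFInjectiveMacaulayficationRegularPointClause
import Summits.ResolutionOfSingularities.ResolutionOfSingularities.Theorems.FrobeniusLadderFInjectiveMacaulayficationIsBlowupStalkTransfer
import Summits.ResolutionOfSingularities.ResolutionOfSingularities.Theorems.FrobeniusLadderFInjectiveMacaulayficationDegreeZeroDescentLocal
import HarnessLib

/-!
# W-LINE RUNG W2 — `WFixClosed` for AFFINE varieties of dimension `≤ 2`: at a non-normal bad closed point `b` there is a global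
# non-zero centre `J ∋ b` every blowing up along which is FULL at every point over `supp J` (in fact at EVERY point), modulo Lipman
# 1978 BY NAME and S-V BY NAME (crux `FInjectiveMacaulayfication` stmt-ResolutionOfSingularities-15315, chain w45a;
# res-L1-w45a-plan-1 R13.41 (3); statement = res-L1-w45a-strat-1 `H4LocRepairSig.lean` v1.2 c95fa37a9b121aaa §9′
# (v1.4 9829be837b63b581) `WFixClosedAffineDim2` with its `def`/`abbrev`s (`CMCl`, `FCl`, `FullCl`, `TameAt`, `CentreData`) EXPANDED; prover res-L1-w45a-stub-4)

[OURS · L1 W4.5a] Support file (`--supports stmt-ResolutionOfSingularities-15315 --as helper`); NOT a statement of any manuscript;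
no definitions, no named fact introduced (hypotheses BY NAME: the tree's named fact `Lipman1978SequenceFinite` and the tree's
`@[conjecture] def FCForallExistsDimLe2.FiniteModificationOfBlowupIsBlowup` = S-V, being discharged by res-L1-w45a-stub-7);
AI-written (AI review is weaker than expert review). Replaces the role of NOTHING in H. Hironaka's manuscript.

`wfixClosedAffineDim2_of_lipman hL hV` IS strat-1's `stub_rungW2_of_lipman hL` with the extra hypothesis `hV` (S-V) and the Sig's
abbreviations unfolded: strat-1 closes `stub_rungW2_of_lipman` by `unfold WFixClosedAffineDim2 TameAt; exact wfixClosedAffineDim2_of_lipman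
hL hV` once S-V is a theorem (or keeps `hV`). PROOF: `RegularBlowupModelDim2.exists_regular_isBlowup_of_lipman` gives a REGULAR `Y`
with `IsBlowup π J`, `J ≠ ⊥`; every blowing up `X'` of `J` has the stalks of `Y` (`IsBlowupStalkTransfer`), which are regular, hence FULL
(`RegularPointClause.fiClause_stalk_of_isRegularLocalRing`, transported by `DegreeZeroDescent.inlineClause_of_ringEquiv`); and
`b ∈ supp J`, for otherwise `π` is an isomorphism over a neighbourhood of `b` and `𝒪_{X₁,b}` ≅ a regular stalk of `Y` would satisfy
the F-clause, contradicting the badness of `b` (the non-normality of `b` and the other admissibility hypotheses are not used).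
[folklore assembly; cite: Liu2002, Thm. 8.3.44 (PDF p. 427); StacksProject, Tags 080B, 02OS]
-/

-- single-problem summit: the doubled namespace component is forced
set_option linter.dupNamespace false

noncomputable section

open AlgebraicGeometry CategoryTheory Literature.AlgebraicGeometry.Resolution TopologicalSpace

namespace Summit.ResolutionOfSingularities.ResolutionOfSingularities.Theorems.FInjectiveMacaulayfication.WFixClosedAffineDim2

open Summit.ResolutionOfSingularities.ResolutionOfSingularities.Theorems.FInjectiveMacaulayfication
open Summit.ResolutionOfSingularities.ResolutionOfSingularities.Theorems.FInjectiveMacaulayfication.FCForallExistsDimLe2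
open Summit.ResolutionOfSingularities.ResolutionOfSingularities.Theorems.FInjectiveMacaulayfication.RegularBlowupModelDim2

/-- **EVERY blowing up along the centre of a REGULAR blow-up model is FULL at EVERY stalk** (two blowing ups along the same ideal
sheaf have the same stalks; regular local rings are F-injective Cohen–Macaulay domains). [folklore] -/
theorem full_of_isBlowup_of_regular (p : ℕ) [Fact p.Prime] {k : Type} [Field k] [CharP k p] {X₁ Y : Scheme.{0}}
    (g : Y ⟶ Spec (.of k)) {π : Y ⟶ X₁} {J : X₁.IdealSheafData} (hπ : IsBlowup π J) (hreg : Scheme.IsRegular Y) :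
    ∀ (X' : Scheme.{0}) (π' : X' ⟶ X₁), IsBlowup π' J → ∀ x' : X',
      IsDomain (X'.presheaf.stalk x') ∧ ∀ d : ℕ, ringKrullDim (X'.presheaf.stalk x') = d →
        ∀ s : Fin d → X'.presheaf.stalk x', (Ideal.span (Set.range s)).radical.IsMaximal →
          RingTheory.Sequence.IsWeaklyRegular (X'.presheaf.stalk x') (List.ofFn s) ∧
          ∀ y : X'.presheaf.stalk x', (∃ e : ℕ, y ^ p ^ e ∈ Ideal.span
            ((fun z : X'.presheaf.stalk x' => z ^ p ^ e) '' (Ideal.span (Set.range s) : Set (X'.presheaf.stalk x')))) →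
            y ∈ Ideal.span (Set.range s) := by
  intro X' π' hπ' x'
  obtain ⟨y, -, ⟨e⟩⟩ := IsBlowupStalkTransfer.stub_isBlowupStalkTransfer X₁ X' Y J π' π hπ' hπ x'
  obtain ⟨hdom, hcl⟩ := RegularPointClause.fiClause_stalk_of_isRegularLocalRing p g y (hreg y)
  haveI := hdom
  exact ⟨MulEquiv.isDomain _ e.toMulEquiv, DegreeZeroDescent.inlineClause_of_ringEquiv p e.symm hcl⟩

/-- **W2 — `WFixClosed` FOR AFFINE VARIETIES OF DIMENSION `≤ 2`, modulo Lipman 1978 and S-V** (strat-1's `WFixClosedAffineDim2`,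
expanded, v1.4 binder order): for `X₁` affine integral of finite type over a field of characteristic `p` with `dim X₁ ≤ 2`
(all stalks Cohen–Macaulay, finitely many non-F-closed points — unused), and a closed point `b` whose local ring is not Frobenius-closed on
parameters (and not integrally closed — unused), there is a non-zero ideal sheaf `J` with `b ∈ supp J` such that every blowing up of
`X₁` along `J` is an integral-stalked, Cohen–Macaulay, F-closed-on-parameters scheme at every point over `supp J`.
[folklore assembly; cite: Liu2002, Thm. 8.3.44 (PDF p. 427)] -/
theorem wfixClosedAffineDim2_of_lipman (hL : Lipman1978SequenceFinite.{0}) (hV : FiniteModificationOfBlowupIsBlowup) :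
    ∀ (p : ℕ), p.Prime → ∀ (k : Type) [Field k] [CharP k p] (X₁ : Scheme.{0}) (f₁ : X₁ ⟶ Spec (.of k)),
    IsSeparated f₁ → LocallyOfFiniteType f₁ → QuasiCompact f₁ → IsIntegral X₁ → topologicalKrullDim X₁ ≤ 2 → IsAffine X₁ →
    (∀ x : X₁, ∀ d : ℕ, ringKrullDim (X₁.presheaf.stalk x) = d → ∀ s : Fin d → X₁.presheaf.stalk x,
      (Ideal.span (Set.range s)).radical.IsMaximal → RingTheory.Sequence.IsWeaklyRegular (X₁.presheaf.stalk x) (List.ofFn s)) →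
    Set.Finite {x : X₁ | ¬ ∀ d : ℕ, ringKrullDim (X₁.presheaf.stalk x) = d → ∀ s : Fin d → X₁.presheaf.stalk x,
      (Ideal.span (Set.range s)).radical.IsMaximal →
        ∀ y : X₁.presheaf.stalk x, (∃ e : ℕ, y ^ p ^ e ∈ Ideal.span ((fun z : X₁.presheaf.stalk x => z ^ p ^ e) ''
          (Ideal.span (Set.range s) : Set (X₁.presheaf.stalk x)))) → y ∈ Ideal.span (Set.range s)} →
    ∀ b : X₁, IsClosed ({b} : Set X₁) →
      ¬ (∀ d : ℕ, ringKrullDim (X₁.presheaf.stalk b) = d → ∀ s : Fin d → X₁.presheaf.stalk b,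
        (Ideal.span (Set.range s)).radical.IsMaximal →
          ∀ y : X₁.presheaf.stalk b, (∃ e : ℕ, y ^ p ^ e ∈ Ideal.span ((fun z : X₁.presheaf.stalk b => z ^ p ^ e) ''
            (Ideal.span (Set.range s) : Set (X₁.presheaf.stalk b)))) → y ∈ Ideal.span (Set.range s)) →
      ¬ IsIntegrallyClosed (X₁.presheaf.stalk b) →
      ∃ J : X₁.IdealSheafData, J ≠ ⊥ ∧ b ∈ (J.support : Set X₁) ∧
        ∀ (X' : Scheme.{0}) (π : X' ⟶ X₁), IsBlowup π J →
          ∀ x' : X', π.base x' ∈ (J.support : Set X₁) →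
            IsDomain (X'.presheaf.stalk x') ∧ ∀ d : ℕ, ringKrullDim (X'.presheaf.stalk x') = d →
              ∀ s : Fin d → X'.presheaf.stalk x', (Ideal.span (Set.range s)).radical.IsMaximal →
                RingTheory.Sequence.IsWeaklyRegular (X'.presheaf.stalk x') (List.ofFn s) ∧
                ∀ y : X'.presheaf.stalk x', (∃ e : ℕ, y ^ p ^ e ∈ Ideal.span
                  ((fun z : X'.presheaf.stalk x' => z ^ p ^ e) '' (Ideal.span (Set.range s) : Set (X'.presheaf.stalk x')))) →
                  y ∈ Ideal.span (Set.range s) := by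
  intro p hp k _ _ X₁ f₁ hsep hft hqc hint hdim haff _ _ b _ hb _
  haveI := hsep; haveI := hft; haveI := hqc; haveI := hint; haveI := haff
  haveI : Fact p.Prime := ⟨hp⟩
  obtain ⟨Y, g, π, J, hJ, hπ, hreg⟩ := exists_regular_isBlowup_of_lipman hL hV X₁ f₁ hdim
  refine ⟨J, hJ, ?_, fun X' π' hπ' x' _ => full_of_isBlowup_of_regular p g hπ hreg X' π' hπ' x'⟩
  -- `b ∈ supp J`: otherwise `𝒪_{X₁,b}` is isomorphic to a (regular) stalk of `Y`, hence F-closed on parameters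
  by_contra hbJ
  obtain ⟨y, hy⟩ := exists_preimage_of_isBlowup_of_not_mem hπ b hbJ
  subst hy
  haveI := isIso_stalkMap_of_isBlowup_of_not_mem hπ y hbJ
  obtain ⟨-, hcl⟩ := RegularPointClause.fiClause_stalk_of_isRegularLocalRing p g y (hreg y)
  have hclb := DegreeZeroDescent.inlineClause_of_ringEquiv p (asIso (π.stalkMap y)).commRingCatIsoToRingEquiv.symm hcl
  exact hb fun d hd s hs => (hclb d hd s hs).2

end Summit.ResolutionOfSingularities.ResolutionOfSingularities.Theorems.FInjectiveMacaulayfication.WFixClosedAffineDim2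

end
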